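import Summits.NavierStokesRegularity.NavierStokesRegularity.Theorems.CoriolisHeadCounterRotatingLiouvilleCalculus
import Literature.Analysis.FluidPDE.TsaiLocalPressure

/-!
# Route CoriolisHead · crux `CounterRotatingLiouville` (stmt-NavierStokesRegularity-22677) —
# towards stub 2 `stub_rssHeadGrowth`: weighted bounds for the rotation terms and harmonicity of
# `P − p̃[θU]` for the rotated profile system

Support file of the line `tsai-rotating-head-chain` (theorems only; `--supports
stmt-NavierStokesRegularity-22677 --as helper`).  First part of the port of the tree's
`FluidPDE/TsaiLocalPressure` (Tsai 1998, Lemma 2.1 localised) from Leray's system to the ROTATED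
profile system `−νΔU + aU + a(y·∇)U + (BU − (By·∇)U) + (U·∇)U + ∇P = 0`, `div U = 0`, `B` skew:

* `abs_integral_weight_mul_inner_clm_apply_le`: `|∫ Ψ ⟪B(U w), e⟫| ≤ ‖e‖ ‖B‖ M₀ ∫_S |U|`;
* `abs_integral_weight_mul_inner_fderiv_apply_clm_le`: for skew `B` (so `div (w ↦ Bw) = tr B = 0`),
  `|∫ Ψ ⟪DU(w)(Bw), e⟫ dw| ≤ ‖e‖ M₁ ‖B‖ R ∫_S |U|` — the derivative is moved onto the weight by
  the trilinear identity with the linear field `X = B`;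
* `laplacian_pressure_sub_localPressure_eq_zero_of_rotated`: `P − p̃[θ_{x₀,ρ}U]` is harmonic on
  `B(x₀, 4ρ)` (the pressure Poisson equation is rotation-blind, `laplacian_pressure_eq_of_rotated`);
* `abs_integral_weight_mul_fderiv_pressure_le_of_rotated`: the weighted average of `∂ₑP` is
  bounded by `‖e‖ [(ν M₂ + (a + ‖B‖) M₀ + a (M₁ R + 3 M₀) + M₁ ‖B‖ R) ∫_S |U| + M₁ ∫_S |U|²]`.

NS regularity is NOT proved here.
-/

noncomputable section

-- the summit and its single sub-problem share the name (CONVENTIONS §1), as in every Theorems file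
set_option linter.dupNamespace false

open MeasureTheory Set Function Filter Topology InnerProductSpace Metric
open scoped RealInnerProductSpace Laplacian ContDiff BigOperators ENNReal NNReal
open Literature.Analysis.FluidPDE

namespace Summit.NavierStokesRegularity.NavierStokesRegularity.Theorems.CoriolisHead

/-! ### Weighted bounds for the two rotation terms -/

section Weighted

variable {E : Type*} [NormedAddCommGroup E] [InnerProductSpace ℝ E] [FiniteDimensional ℝ E]
  [MeasurableSpace E] [BorelSpace E]
variable {Ψ : E → ℝ} {U : E → E} {S : Set E}

/-- **`|∫ Ψ ⟪B(U w), e⟫| ≤ ‖e‖ ‖B‖ M₀ ∫_S ‖U‖`** for a weight `|Ψ| ≤ M₀` supported in `S` and a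
continuous linear `B`. -/
theorem abs_integral_weight_mul_inner_clm_apply_le (B : E →L[ℝ] E) (hS : MeasurableSet S)
    (hΨS : tsupport Ψ ⊆ S) {M₀ : ℝ} (hM₀ : 0 ≤ M₀) (hΨ : ∀ w, |Ψ w| ≤ M₀)
    (hUS : IntegrableOn (fun w => ‖U w‖) S) (e : E) :
    |∫ w, Ψ w * ⟪B (U w), e⟫| ≤ ‖e‖ * ‖B‖ * M₀ * ∫ w in S, ‖U w‖ := by
  refine abs_integral_le_of_support_subset hS
    (fun w hw => by rw [image_eq_zero_of_notMem_tsupport fun h => hw (hΨS h), zero_mul])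
    (fun w _ => ?_) hUS
  rw [abs_mul]
  calc |Ψ w| * |⟪B (U w), e⟫| ≤ M₀ * (‖B (U w)‖ * ‖e‖) :=
        mul_le_mul (hΨ w) (abs_real_inner_le_norm _ _) (abs_nonneg _) hM₀
    _ ≤ M₀ * ((‖B‖ * ‖U w‖) * ‖e‖) := by gcongr; exact B.le_opNorm _
    _ = ‖e‖ * ‖B‖ * M₀ * ‖U w‖ := by ring

omit [FiniteDimensional ℝ E] [MeasurableSpace E] [BorelSpace E] in
/-- The derivative of `w ↦ Ψ(w) • e` applied to `h` is `(DΨ(w) h) • e`. -/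
private theorem fderiv_weight_smul_const_apply' {Ψ : E → ℝ} (hΨ : Differentiable ℝ Ψ)
    (e w h : E) : fderiv ℝ (fun w => Ψ w • e) w h = (fderiv ℝ Ψ w h) • e := by
  rw [fderiv_smul_const (hΨ w), ContinuousLinearMap.smulRight_apply]

/-- **`|∫ Ψ ⟪DU(w) (Bw), e⟫ dw| ≤ ‖e‖ M₁ ‖B‖ R ∫_S ‖U‖`** for a SKEW continuous linear `B`
(`⟪Bx, x⟫ = 0`, so `div (w ↦ Bw) = tr B = 0`), `Ψ ∈ C¹_c` supported in `S` with `‖DΨ‖ ≤ M₁`,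
`‖w‖ ≤ R` on `S`, and `U ∈ C¹` (trilinear identity `∫ ⟪(X·∇)U, W⟫ + ∫ ⟪U, (X·∇)W⟫ + ∫ (div X)⟪U, W⟫
= 0` with `X = B`, `W = Ψ e`). -/
theorem abs_integral_weight_mul_inner_fderiv_apply_clm_le {B : E →L[ℝ] E}
    (hB : ∀ x, ⟪B x, x⟫ = 0) (hS : MeasurableSet S) (hΨ : ContDiff ℝ 1 Ψ)
    (hΨc : HasCompactSupport Ψ) (hΨS : tsupport Ψ ⊆ S) {M₁ R : ℝ} (hM₁ : 0 ≤ M₁) (hR : 0 ≤ R)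
    (hΨ1 : ∀ w, ‖fderiv ℝ Ψ w‖ ≤ M₁) (hSR : ∀ w ∈ S, ‖w‖ ≤ R) (hU : ContDiff ℝ 1 U)
    (hUS : IntegrableOn (fun w => ‖U w‖) S) (e : E) :
    |∫ w, Ψ w * ⟪fderiv ℝ U w (B w), e⟫| ≤ ‖e‖ * M₁ * ‖B‖ * R * ∫ w in S, ‖U w‖ := by
  have hW : ContDiff ℝ 1 fun w => Ψ w • e := hΨ.smul contDiff_const
  have hWc : HasCompactSupport fun w => Ψ w • e := hΨc.smul_right (f' := fun _ : E => e)
  have hΨd : Differentiable ℝ Ψ := hΨ.differentiable one_ne_zero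
  have key := integral_inner_convect_add_eq_zero (u := fun x : E => B x) (v := U)
    (w := fun w => Ψ w • e) B.contDiff hU hW hWc
  have h1 : ∀ w, ⟪convect (fun x : E => B x) U w, Ψ w • e⟫ = Ψ w * ⟪fderiv ℝ U w (B w), e⟫ :=
    fun w => by rw [convect_apply, inner_smul_right]
  have h2 : ∀ w, ⟪U w, convect (fun x : E => B x) (fun w => Ψ w • e) w⟫ =
      fderiv ℝ Ψ w (B w) * ⟪U w, e⟫ := fun w => by
    rw [convect_apply, fderiv_weight_smul_const_apply' hΨd, inner_smul_right]
  have h3 : ∀ w, VectorCalculus.divergence (fun x : E => B x) w * ⟪U w, Ψ w • e⟫ = 0 := fun w => by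
    rw [divergence_eq_traceCLM, show (fun x : E => B x) = (B : E → E) from rfl, B.fderiv,
      traceCLM_eq_zero_of_skew hB, zero_mul]
  simp_rw [h1, h2, h3] at key
  rw [integral_zero, add_zero] at key
  have hI : ∫ w, Ψ w * ⟪fderiv ℝ U w (B w), e⟫ = -∫ w, fderiv ℝ Ψ w (B w) * ⟪U w, e⟫ := by
    linarith
  rw [hI, abs_neg]
  refine abs_integral_le_of_support_subset hS (fun w hw => ?_) (fun w hw => ?_) hUS
  · rw [fderiv_of_notMem_tsupport ℝ fun h => hw (hΨS h), _root_.zero_apply, zero_mul]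
  · rw [abs_mul]
    have hD : |fderiv ℝ Ψ w (B w)| ≤ M₁ * (‖B‖ * R) := by
      rw [← Real.norm_eq_abs]
      calc ‖fderiv ℝ Ψ w (B w)‖ ≤ ‖fderiv ℝ Ψ w‖ * ‖B w‖ := ContinuousLinearMap.le_opNorm _ _
        _ ≤ M₁ * (‖B‖ * ‖w‖) := mul_le_mul (hΨ1 w) (B.le_opNorm w) (norm_nonneg _) hM₁
        _ ≤ M₁ * (‖B‖ * R) := by gcongr; exact hSR w hw
    calc |fderiv ℝ Ψ w (B w)| * |⟪U w, e⟫| ≤ (M₁ * (‖B‖ * R)) * (‖U w‖ * ‖e‖) :=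
          mul_le_mul hD (abs_real_inner_le_norm _ _) (abs_nonneg _) (by positivity)
      _ = ‖e‖ * M₁ * ‖B‖ * R * ‖U w‖ := by ring

end Weighted

/-! ### Harmonicity of `P − p̃[θU]` and the weighted pressure-gradient bound on `ℝ³` -/

section LocalPressure

-- nested operator types `ℝ³ →L[ℝ] ℝ³ →L[ℝ] ℝ³ →L[ℝ] ℝ`
set_option maxSynthPendingDepth 3

variable {ν a : ℝ} {B : EuclideanSpace ℝ (Fin 3) →L[ℝ] EuclideanSpace ℝ (Fin 3)}
  {U : EuclideanSpace ℝ (Fin 3) → EuclideanSpace ℝ (Fin 3)} {P : EuclideanSpace ℝ (Fin 3) → ℝ}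
  {ρ : ℝ} {x₀ : EuclideanSpace ℝ (Fin 3)}

/-- **`P − p̃[θ_{x₀}U]` is harmonic on `B(x₀, 4ρ)` for a rotated profile**: there `θ = 1`, so
`Δp̃[θU] = −∂ᵢ∂ⱼ(UᵢUⱼ) = −tr (DU∘DU) = ΔP` (`laplacian_pressure_eq_of_rotated`: the rotation term is
divergence free).  Port of `IsLerayProfile.laplacian_pressure_sub_localPressure_eq_zero`. -/
theorem laplacian_pressure_sub_localPressure_eq_zero_of_rotated (hU : ContDiff ℝ ∞ U)
    (hP2 : ContDiff ℝ 2 P) (hdiv : VectorCalculus.IsDivFree U)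
    (heq : ∀ y, -(ν • (Δ U) y) + a • U y + a • fderiv ℝ U y y + (B (U y) - fderiv ℝ U y (B y)) +
      convect U U y + gradient P y = 0)
    (hρ : 0 < ρ) {x : EuclideanSpace ℝ (Fin 3)} (hx : x ∈ ball x₀ (4 * ρ)) :
    (Δ (fun y => P y - normalisedPressure
      (fun w : EuclideanSpace ℝ (Fin 3) => cutoff (4 * ρ) (w - x₀) • U w) y)) x = 0 := by
  have hU3 : ContDiff ℝ 3 U := hU.of_le (by norm_cast)
  have hU2 : ContDiff ℝ 2 U := hU.of_le (by norm_cast)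
  have hN2 := contDiff_normalisedPressure_locF hU hρ (x₀ := x₀)
  have hfun : (fun y => P y - normalisedPressure
      (fun w : EuclideanSpace ℝ (Fin 3) => cutoff (4 * ρ) (w - x₀) • U w) y) =
      P - normalisedPressure (fun w : EuclideanSpace ℝ (Fin 3) => cutoff (4 * ρ) (w - x₀) • U w) :=
    rfl
  rw [hfun, hP2.contDiffAt.laplacian_sub hN2.contDiffAt, laplacian_normalisedPressure_locF hU hρ x,
    sub_neg_eq_add, laplacian_pressure_eq_of_rotated hU3 hP2 hdiv heq x]
  have hgerm : (fun w : EuclideanSpace ℝ (Fin 3) => cutoff (4 * ρ) (w - x₀) • U w) =ᶠ[𝓝 x] U := by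
    filter_upwards [isOpen_ball.mem_nhds hx] with y hy
    exact locF_eq_self hρ (ball_subset_closedBall hy)
  rw [pressureSource_congr_of_eventuallyEq hgerm, pressureSource_eq_of_isDivFree hdiv,
    divergence_convect_self_eq hU2 hdiv x]
  ring

/-- **The weighted average of `∂ₑP` is controlled by `L¹`/`L²` norms of `U`** for the rotated
system: for `U ∈ C^∞`, `B` skew, a weight `Ψ ∈ C²_c` supported in `S ⊆ B̄(0, R)` with `|Ψ| ≤ M₀`,
`‖DΨ‖ ≤ M₁`, `|ΔΨ| ≤ M₂`,
`|∫ Ψ ∂ₑP| ≤ ‖e‖ [(ν M₂ + (a + ‖B‖) M₀ + a (M₁ R + 3 M₀) + M₁ ‖B‖ R) ∫_S |U| + M₁ ∫_S |U|²]`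
(`∇P = νΔU − aU − a(y·∇)U − BU + (By·∇)U − (U·∇)U`, every derivative moved onto the weight).
Port of `IsLerayProfile.abs_integral_weight_mul_fderiv_pressure_le`. -/
theorem abs_integral_weight_mul_fderiv_pressure_le_of_rotated (hU : ContDiff ℝ ∞ U)
    (hB : ∀ x, ⟪B x, x⟫ = 0) (hdiv : VectorCalculus.IsDivFree U)
    (heq : ∀ y, -(ν • (Δ U) y) + a • U y + a • fderiv ℝ U y y + (B (U y) - fderiv ℝ U y (B y)) +
      convect U U y + gradient P y = 0)
    (hν : 0 ≤ ν) (ha : 0 ≤ a) {Ψ : EuclideanSpace ℝ (Fin 3) → ℝ} (hΨ : ContDiff ℝ 2 Ψ)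
    (hΨc : HasCompactSupport Ψ) {S : Set (EuclideanSpace ℝ (Fin 3))} (hS : MeasurableSet S)
    (hScpt : IsCompact S) (hΨS : tsupport Ψ ⊆ S) {M₀ M₁ M₂ R : ℝ} (hM₀ : 0 ≤ M₀) (hM₁ : 0 ≤ M₁)
    (hM₂ : 0 ≤ M₂) (hR : 0 ≤ R) (hΨ0 : ∀ w, |Ψ w| ≤ M₀) (hΨ1 : ∀ w, ‖fderiv ℝ Ψ w‖ ≤ M₁)
    (hΨ2 : ∀ w, |(Δ Ψ) w| ≤ M₂) (hSR : ∀ w ∈ S, ‖w‖ ≤ R) (e : EuclideanSpace ℝ (Fin 3)) :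
    |∫ w, Ψ w * fderiv ℝ P w e| ≤
      ‖e‖ * ((ν * M₂ + (a + ‖B‖) * M₀ + a * (M₁ * R + 3 * M₀) + M₁ * ‖B‖ * R) * (∫ w in S, ‖U w‖) +
        M₁ * ∫ w in S, ‖U w‖ ^ 2) := by
  have hU2 : ContDiff ℝ 2 U := hU.of_le (by norm_cast)
  have hU1 : ContDiff ℝ 1 U := hU.of_le (by norm_cast)
  have hΨ1' : ContDiff ℝ 1 Ψ := hΨ.of_le one_le_two
  have hUc : Continuous U := hU.continuous
  have hIU : IntegrableOn (fun w => ‖U w‖) S := hUc.norm.continuousOn.integrableOn_compact hScpt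
  have hIU2 : IntegrableOn (fun w => ‖U w‖ ^ 2) S :=
    (hUc.norm.pow 2).continuousOn.integrableOn_compact hScpt
  -- `∂ₑP = ν ⟪ΔU, e⟫ − a ⟪U, e⟫ − a ⟪DU w w, e⟫ − ⟪B U, e⟫ + ⟪DU w (Bw), e⟫ − ⟪(U·∇)U, e⟫`
  have hpt : ∀ w, Ψ w * fderiv ℝ P w e = ν * (Ψ w * ⟪(Δ U) w, e⟫) - a * (Ψ w * ⟪U w, e⟫)
      - a * (Ψ w * ⟪fderiv ℝ U w w, e⟫) - Ψ w * ⟪B (U w), e⟫ + Ψ w * ⟪fderiv ℝ U w (B w), e⟫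
      - Ψ w * ⟪convect U U w, e⟫ := fun w => by
    rw [← inner_gradient_left, gradient_pressure_eq_of_rotated heq w]
    simp only [inner_sub_left, inner_smul_left, RCLike.conj_to_real]
    ring
  have hint : ∀ {G : EuclideanSpace ℝ (Fin 3) → ℝ}, Continuous G → Integrable fun w => Ψ w * G w :=
    fun hG => (hΨ.continuous.mul hG).integrable_of_hasCompactSupport hΨc.mul_right
  have hc1 : Continuous fun w => ⟪(Δ U) w, e⟫ :=
    (Literature.Analysis.FluidPDE.continuous_laplacian hU2).inner continuous_const
  have hc2 : Continuous fun w => ⟪U w, e⟫ := hUc.inner continuous_const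
  have hc3 : Continuous fun w => ⟪fderiv ℝ U w w, e⟫ :=
    ((hU1.continuous_fderiv one_ne_zero).clm_apply continuous_id).inner continuous_const
  have hc5 : Continuous fun w => ⟪B (U w), e⟫ := (B.continuous.comp hUc).inner continuous_const
  have hc6 : Continuous fun w => ⟪fderiv ℝ U w (B w), e⟫ :=
    ((hU1.continuous_fderiv one_ne_zero).clm_apply B.continuous).inner continuous_const
  have hc4 : Continuous fun w => ⟪convect U U w, e⟫ :=
    ((hU1.continuous_fderiv one_ne_zero).clm_apply hUc).inner continuous_const
  have hsplit : ∫ w, Ψ w * fderiv ℝ P w e = ν * (∫ w, Ψ w * ⟪(Δ U) w, e⟫) - a * (∫ w, Ψ w * ⟪U w, e⟫)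
      - a * (∫ w, Ψ w * ⟪fderiv ℝ U w w, e⟫) - (∫ w, Ψ w * ⟪B (U w), e⟫)
      + (∫ w, Ψ w * ⟪fderiv ℝ U w (B w), e⟫) - ∫ w, Ψ w * ⟪convect U U w, e⟫ := by
    simp_rw [hpt]
    rw [integral_sub, integral_add, integral_sub, integral_sub, integral_sub, integral_const_mul,
      integral_const_mul, integral_const_mul]
    · exact (hint hc1).const_mul ν
    · exact (hint hc2).const_mul a
    · exact ((hint hc1).const_mul ν).sub ((hint hc2).const_mul a)
    · exact (hint hc3).const_mul a
    · exact (((hint hc1).const_mul ν).sub ((hint hc2).const_mul a)).sub ((hint hc3).const_mul a)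
    · exact hint hc5
    · exact ((((hint hc1).const_mul ν).sub ((hint hc2).const_mul a)).sub
        ((hint hc3).const_mul a)).sub (hint hc5)
    · exact hint hc6
    · exact (((((hint hc1).const_mul ν).sub ((hint hc2).const_mul a)).sub
        ((hint hc3).const_mul a)).sub (hint hc5)).add (hint hc6)
    · exact hint hc4
  have b1 := abs_integral_weight_mul_inner_laplacian_le hS hΨ hΨc hΨS hM₂ hΨ2 hU2 hIU e
  have b2 := abs_integral_weight_mul_inner_le hS hΨS hM₀ hΨ0 hIU e (U := U)
  have b3 := abs_integral_weight_mul_inner_fderiv_apply_self_le hS hΨ1' hΨc hΨS hM₀ hM₁ hR hΨ0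
    hΨ1 hSR hU1 hIU e
  have b4 := abs_integral_weight_mul_inner_convect_le hS hΨ1' hΨc hΨS hM₁ hΨ1 hU1 hdiv hIU2 e
  have b5 := abs_integral_weight_mul_inner_clm_apply_le B hS hΨS hM₀ hΨ0 hIU e (U := U)
  have b6 := abs_integral_weight_mul_inner_fderiv_apply_clm_le hB hS hΨ1' hΨc hΨS hM₁ hR hΨ1 hSR
    hU1 hIU e
  rw [finrank_euclideanSpace_fin] at b3
  push_cast at b3
  have hI1 : 0 ≤ ∫ w in S, ‖U w‖ := integral_nonneg fun w => norm_nonneg _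
  have hI2 : 0 ≤ ∫ w in S, ‖U w‖ ^ 2 := integral_nonneg fun w => by positivity
  have hBn : 0 ≤ ‖B‖ := norm_nonneg _
  rw [hsplit]
  set I₁ := ∫ w, Ψ w * ⟪(Δ U) w, e⟫ with hI₁d
  set I₂ := ∫ w, Ψ w * ⟪U w, e⟫ with hI₂d
  set I₃ := ∫ w, Ψ w * ⟪fderiv ℝ U w w, e⟫ with hI₃d
  set I₄ := ∫ w, Ψ w * ⟪convect U U w, e⟫ with hI₄d
  set I₅ := ∫ w, Ψ w * ⟪B (U w), e⟫ with hI₅d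
  set I₆ := ∫ w, Ψ w * ⟪fderiv ℝ U w (B w), e⟫ with hI₆d
  set J₁ := ∫ w in S, ‖U w‖ with hJ₁d
  set J₂ := ∫ w in S, ‖U w‖ ^ 2 with hJ₂d
  have htri : |ν * I₁ - a * I₂ - a * I₃ - I₅ + I₆ - I₄| ≤
      ν * |I₁| + a * |I₂| + a * |I₃| + |I₅| + |I₆| + |I₄| := by
    have h1 := abs_sub (ν * I₁ - a * I₂ - a * I₃ - I₅ + I₆) I₄
    have h1' := abs_add_le (ν * I₁ - a * I₂ - a * I₃ - I₅) I₆
    have h1'' := abs_sub (ν * I₁ - a * I₂ - a * I₃) I₅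
    have h2 := abs_sub (ν * I₁ - a * I₂) (a * I₃)
    have h3 := abs_sub (ν * I₁) (a * I₂)
    rw [abs_mul, abs_mul, abs_of_nonneg hν, abs_of_nonneg ha] at h3
    rw [abs_mul, abs_of_nonneg ha] at h2
    linarith
  calc |ν * I₁ - a * I₂ - a * I₃ - I₅ + I₆ - I₄|
      ≤ ν * |I₁| + a * |I₂| + a * |I₃| + |I₅| + |I₆| + |I₄| := htri
    _ ≤ ν * (‖e‖ * M₂ * J₁) + a * (‖e‖ * M₀ * J₁) + a * (‖e‖ * (M₁ * R + 3 * M₀) * J₁)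
        + ‖e‖ * ‖B‖ * M₀ * J₁ + ‖e‖ * M₁ * ‖B‖ * R * J₁ + ‖e‖ * M₁ * J₂ := by gcongr
    _ = ‖e‖ * ((ν * M₂ + (a + ‖B‖) * M₀ + a * (M₁ * R + 3 * M₀) + M₁ * ‖B‖ * R) * J₁ + M₁ * J₂) := by
        ring

end LocalPressure

end Summit.NavierStokesRegularity.NavierStokesRegularity.Theorems.CoriolisHead

end
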